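import Literature.Analysis.FunctionSpaces.KantorovichLogDistanceDuality
import Literature.Analysis.FunctionSpaces.TorusMaximalLipschitz
import Literature.Analysis.FunctionSpaces.LadyzhenskayaTorus
import Literature.Analysis.FunctionSpaces.TorusMollifiedGradNorm
import HarnessLib

/-!
# The transport pairing of the logarithmic Kantorovich distance (Seis 2022, Lemma 3, core)

Analysis/FunctionSpaces support file (everything proved; one auxiliary `def`, the constant).
For a mean-zero `θ ∈ L²(T^d)`, `δ > 0`, an optimal plan `π ∈ Π(θ⁺dx, θ⁻dx)` and optimal
log-Lipschitz potential `ζ` of `D_δ(θ)` (`KantorovichLogDistanceDuality.exists_isCoupling_gradient`: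
`∇ζ(x) = ∇ζ(y)` and `|∇ζ(x)| ≤ (δ + |x - y|)⁻¹` for `π`-a.e. `(x, y)`), and a drift `u`, the
transport pairing satisfies

  `|∫ θ ⟪u, ∇ζ⟫ dx| ≤ C(d) ‖θ‖_{L²} ‖∇u‖_{L²}`  (`enorm_integral_mul_inner_gradient_le`),

uniformly in `δ`. This is the heart of Seis' proof of Lemma 3 (p. 7–8):
`∫ θ ⟪u,∇ζ⟫ = ∫∫ ⟪u(x) - u(y), ∇ζ(x)⟫ dπ`, `|⟪u(x) - u(y), ∇ζ(x)⟫| ≤ |u(x) - u(y)|/|x - y|`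
`≲ (M|∇u|)(x) + (M|∇u|)(y)` (the Crippa–De Lellis maximal-function estimate,
`TorusMaximalLipschitz.exists_maximal_majorant`), the marginals of `π` are `θ±dx`, and the
maximal function is bounded on `L²`; for rough `u ∈ L² ∩ Ḣ¹` one mollifies
(`TorusMollifiedGradNorm`).

## References

* C. Seis, *Bounds on the rate of enhanced dissipation*, Comm. Math. Phys. 2022
  (arXiv:2003.08794), Lemma 3 and its proof, pp. 7–8. [`Seis2022`]
* G. Crippa, C. De Lellis, J. reine angew. Math. 616 (2008) (the maximal-function estimate).
-/

noncomputable section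

open MeasureTheory Set Filter Topology UnitAddTorus Function Metric
open scoped ENNReal NNReal Convolution InnerProductSpace

namespace Literature.Analysis.FunctionSpaces

namespace Torus

open Literature.MeasureTheory.OptimalTransport

variable {d : Type*} [Fintype d] [DecidableEq d]

/-! ## The constant -/

/-- The maximal-function constant of `T^d` for `ℝ^d`-valued fields
(`TorusMaximalLipschitz.exists_maximal_majorant`). [folklore] -/
def maximalMajorantConst (d : Type*) [Fintype d] [DecidableEq d] : ℝ≥0∞ :=
  Classical.choose (exists_maximal_majorant d (EuclideanSpace ℝ d))

omit [Fintype d] [DecidableEq d] in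
/-- Specification of `maximalMajorantConst`. [folklore] -/
theorem maximalMajorantConst_spec [Fintype d] [DecidableEq d] :
    maximalMajorantConst d ≠ ⊤ ∧ ∀ u : UnitAddTorus d → EuclideanSpace ℝ d, IsContDiff 1 u →
      ∃ M : UnitAddTorus d → ℝ≥0∞, Measurable M ∧
        (∀ x y, ‖u x - u y‖ₑ ≤ maximalMajorantConst d * ENNReal.ofReal (dist x y) * (M x + M y)) ∧
        ∫⁻ x, M x ^ 2 ≤ maximalMajorantConst d * ∫⁻ x, ‖Torus.fderiv u x‖ₑ ^ 2 :=
  Classical.choose_spec (exists_maximal_majorant d (EuclideanSpace ℝ d))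

/-- The constant of the transport-pairing bound: `C (C #d)^{1/2}` with the maximal-function
constant `C`. [folklore] -/
def pairingConst (d : Type*) [Fintype d] [DecidableEq d] : ℝ≥0∞ :=
  maximalMajorantConst d * (maximalMajorantConst d * Fintype.card d) ^ (1 / 2 : ℝ)

omit [DecidableEq d] in
/-- The pairing constant is finite. [folklore] -/
theorem pairingConst_ne_top [DecidableEq d] : pairingConst d ≠ ⊤ :=
  ENNReal.mul_ne_top maximalMajorantConst_spec.1 (ENNReal.rpow_ne_top_of_nonneg (by norm_num)
    (ENNReal.mul_ne_top maximalMajorantConst_spec.1 (ENNReal.natCast_ne_top _)))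

/-! ## Pairings against `θ` through a coupling of `θ⁺dx` and `θ⁻dx` -/

omit [DecidableEq d] in
/-- **A pairing `∫ θ g` is the `π`-integral of `g(x) - g(y)`** for any coupling `π` of `θ⁺dx`
and `θ⁻dx` and any bounded measurable `g`. [folklore] -/
theorem integral_mul_eq_integral_sub_of_isCoupling {θ : UnitAddTorus d → ℝ} (hθ : Integrable θ volume)
    {π : Measure (UnitAddTorus d × UnitAddTorus d)} (hπ : IsCoupling (posMeasure θ) (negMeasure θ) π)
    {g : UnitAddTorus d → ℝ} (hg : AEStronglyMeasurable g volume) {C : ℝ} (hC : ∀ x, |g x| ≤ C) :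
    ∫ x, θ x * g x = ∫ z, (g z.1 - g z.2) ∂π := by
  haveI := isFiniteMeasure_posMeasure hθ
  haveI := hπ.isFiniteMeasure
  have hg1 : AEStronglyMeasurable g (posMeasure θ) := hg.mono_ac (posMeasure_absolutelyContinuous θ)
  have hg2 : AEStronglyMeasurable g (negMeasure θ) := hg.mono_ac (negMeasure_absolutelyContinuous θ)
  have hf1 : AEStronglyMeasurable (fun z : UnitAddTorus d × UnitAddTorus d => g z.1) π := by
    refine AEStronglyMeasurable.comp_measurable ?_ measurable_fst
    rw [hπ.map_fst]; exact hg1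
  have hf2 : AEStronglyMeasurable (fun z : UnitAddTorus d × UnitAddTorus d => g z.2) π := by
    refine AEStronglyMeasurable.comp_measurable ?_ measurable_snd
    rw [hπ.map_snd]; exact hg2
  have hi1 : Integrable (fun z : UnitAddTorus d × UnitAddTorus d => g z.1) π :=
    Integrable.mono' (integrable_const C) hf1 (Eventually.of_forall fun z => by
      rw [Real.norm_eq_abs]; exact hC _)
  have hi2 : Integrable (fun z : UnitAddTorus d × UnitAddTorus d => g z.2) π :=
    Integrable.mono' (integrable_const C) hf2 (Eventually.of_forall fun z => by
      rw [Real.norm_eq_abs]; exact hC _)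
  rw [integral_sub hi1 hi2, hπ.integral_comp_fst hg1, hπ.integral_comp_snd hg2,
    integral_posMeasure_sub_integral_negMeasure hθ.aestronglyMeasurable (integrable_max_mul hθ hg hC)
      (by simpa using integrable_max_mul hθ.neg hg hC)]

omit [DecidableEq d] in
/-- `∫⁻ (M x + M y) dπ = ∫⁻ |θ| M` for a coupling `π` of `θ⁺dx`, `θ⁻dx` and measurable `M`. [folklore] -/
theorem lintegral_add_comp_eq_of_isCoupling {θ : UnitAddTorus d → ℝ} (hθ : AEStronglyMeasurable θ volume)
    {π : Measure (UnitAddTorus d × UnitAddTorus d)} (hπ : IsCoupling (posMeasure θ) (negMeasure θ) π)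
    {M : UnitAddTorus d → ℝ≥0∞} (hM : Measurable M) :
    ∫⁻ z, (M z.1 + M z.2) ∂π = ∫⁻ x, ‖θ x‖ₑ * M x := by
  have hadd : ∫⁻ z, (M z.1 + M z.2) ∂π = (∫⁻ z, M z.1 ∂π) + ∫⁻ z, M z.2 ∂π :=
    lintegral_add_left (hM.comp measurable_fst) _
  rw [hadd]
  have h1 : ∫⁻ z, M z.1 ∂π = ∫⁻ x, M x ∂(posMeasure θ) := by
    rw [← hπ.map_fst, lintegral_map hM measurable_fst]
  have h2 : ∫⁻ z, M z.2 ∂π = ∫⁻ x, M x ∂(negMeasure θ) := by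
    rw [← hπ.map_snd, lintegral_map hM measurable_snd]
  have hpos : ∫⁻ x, M x ∂(posMeasure θ) = ∫⁻ x, ENNReal.ofReal (θ x) * M x := by
    rw [posMeasure]
    exact lintegral_withDensity_eq_lintegral_mul₀ hθ.aemeasurable.ennreal_ofReal hM.aemeasurable
  have hneg : ∫⁻ x, M x ∂(negMeasure θ) = ∫⁻ x, ENNReal.ofReal (-θ x) * M x := by
    rw [negMeasure]
    exact lintegral_withDensity_eq_lintegral_mul₀ hθ.aemeasurable.neg.ennreal_ofReal hM.aemeasurable
  have hadd' : (∫⁻ x, ENNReal.ofReal (θ x) * M x) + ∫⁻ x, ENNReal.ofReal (-θ x) * M x =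
      ∫⁻ x, (ENNReal.ofReal (θ x) * M x + ENNReal.ofReal (-θ x) * M x) :=
    (lintegral_add_left' (hθ.aemeasurable.ennreal_ofReal.mul hM.aemeasurable) _).symm
  rw [h1, h2, hpos, hneg, hadd']
  refine lintegral_congr fun x => ?_
  rw [← add_mul]
  congr 1
  rw [Real.enorm_eq_ofReal_abs]
  rcases le_total 0 (θ x) with h | h
  · rw [ENNReal.ofReal_of_nonpos (neg_nonpos.2 h), add_zero, abs_of_nonneg h]
  · rw [ENNReal.ofReal_of_nonpos h, zero_add, abs_of_nonpos h]

/-! ## The bound for smooth drifts -/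

omit [DecidableEq d] in
/-- Pointwise size of the pairing integrand difference at a contact pair:
if `∇ζ(x) = ∇ζ(y)` and `|∇ζ(x)| ≤ (δ + |x - y|)⁻¹` then
`|⟪u x, ∇ζ x⟫ - ⟪u y, ∇ζ y⟫| ≤ |u x - u y| (δ + |x - y|)⁻¹`. [folklore] -/
theorem abs_inner_sub_inner_le {u : UnitAddTorus d → EuclideanSpace ℝ d} {ζ : UnitAddTorus d → ℝ}
    {δ : ℝ} {x y : UnitAddTorus d} (hxy : Torus.gradient ζ x = Torus.gradient ζ y)
    (hb : ‖Torus.gradient ζ x‖ ≤ (δ + dist x y)⁻¹) :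
    |⟪u x, Torus.gradient ζ x⟫_ℝ - ⟪u y, Torus.gradient ζ y⟫_ℝ| ≤ ‖u x - u y‖ * (δ + dist x y)⁻¹ := by
  rw [← hxy, ← inner_sub_left]
  exact (abs_real_inner_le_norm _ _).trans (mul_le_mul_of_nonneg_left hb (norm_nonneg _))

/-- **The transport pairing bound for `C¹` drifts** (Seis 2022, proof of Lemma 3): for mean-zero
`θ ∈ L²`, a coupling `π` of `θ⁺dx`, `θ⁻dx`, a `δ`-log-Lipschitz `ζ` with `∇ζ(x) = ∇ζ(y)` and
`|∇ζ(x)| ≤ (δ + |x-y|)⁻¹` for `π`-a.e. `(x,y)`, and a `C¹` field `u`: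
`‖∫ θ ⟪u, ∇ζ⟫‖ₑ ≤ pairingConst d · ‖θ‖_{L²} · ‖∇u‖_{L²}` with the spectral `eGradNormSq`.
[cite: Seis2022, Lemma 3 (proof, p. 8)] -/
theorem enorm_integral_mul_inner_gradient_le_of_isSmooth {θ : UnitAddTorus d → ℝ} (hθ : MemLp θ 2 volume)
    {δ : ℝ} (hδ : 0 < δ) {π : Measure (UnitAddTorus d × UnitAddTorus d)}
    (hπ : IsCoupling (posMeasure θ) (negMeasure θ) π) {ζ : UnitAddTorus d → ℝ} (hζ : IsLogLipschitz δ ζ)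
    (hae : ∀ᵐ z ∂π, Torus.gradient ζ z.1 = Torus.gradient ζ z.2 ∧
      ‖Torus.gradient ζ z.1‖ ≤ (δ + dist z.1 z.2)⁻¹)
    {u : UnitAddTorus d → EuclideanSpace ℝ d} (hu : IsSmooth u) :
    ‖∫ x, θ x * ⟪u x, Torus.gradient ζ x⟫_ℝ‖ₑ ≤
      pairingConst d * eLpNorm θ 2 volume * eGradNormSq u ^ (1 / 2 : ℝ) := by
  have hθi : Integrable θ volume := hθ.integrable one_le_two
  obtain ⟨hCt, hCu⟩ := maximalMajorantConst_spec (d := d)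
  set C : ℝ≥0∞ := maximalMajorantConst d with hC_def
  obtain ⟨M, hMm, hMxy, hM2⟩ := hCu u (hu.isContDiff (by simp))
  -- the pairing integrand `g = ⟪u, ∇ζ⟫` is bounded and measurable
  obtain ⟨Cu, hCu'⟩ := exists_forall_norm_le_of_continuous hu.continuous
  set g : UnitAddTorus d → ℝ := fun x => ⟪u x, Torus.gradient ζ x⟫_ℝ with hg_def
  have hgm : AEStronglyMeasurable g volume :=
    (hu.continuous.aestronglyMeasurable.inner (measurable_gradient ζ).aestronglyMeasurable)
  have hgb : ∀ x, |g x| ≤ Cu * δ⁻¹ := fun x =>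
    (abs_real_inner_le_norm _ _).trans (mul_le_mul (hCu' x) (hζ.norm_gradient_le_inv hδ x) (norm_nonneg _)
      ((norm_nonneg _).trans (hCu' x)))
  -- through the coupling
  rw [integral_mul_eq_integral_sub_of_isCoupling hθi hπ hgm hgb]
  -- pointwise bound `π`-a.e.
  have hpt : ∀ᵐ z ∂π, ‖g z.1 - g z.2‖ₑ ≤ C * (M z.1 + M z.2) := by
    filter_upwards [hae] with z hz
    have h1 := abs_inner_sub_inner_le (u := u) hz.1 hz.2
    have hpos : 0 < δ + dist z.1 z.2 := by positivity
    rw [Real.enorm_eq_ofReal_abs]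
    calc ENNReal.ofReal |g z.1 - g z.2| ≤ ENNReal.ofReal (‖u z.1 - u z.2‖ * (δ + dist z.1 z.2)⁻¹) :=
          ENNReal.ofReal_le_ofReal h1
      _ = ‖u z.1 - u z.2‖ₑ * ENNReal.ofReal ((δ + dist z.1 z.2)⁻¹) := by
          rw [ENNReal.ofReal_mul (norm_nonneg _), ofReal_norm]
      _ ≤ C * ENNReal.ofReal (dist z.1 z.2) * (M z.1 + M z.2) * ENNReal.ofReal ((δ + dist z.1 z.2)⁻¹) :=
          mul_le_mul' (hMxy z.1 z.2) le_rfl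
      _ = C * (M z.1 + M z.2) * (ENNReal.ofReal (dist z.1 z.2) * ENNReal.ofReal ((δ + dist z.1 z.2)⁻¹)) := by ring
      _ ≤ C * (M z.1 + M z.2) * 1 := by
          refine mul_le_mul' le_rfl ?_
          rw [← ENNReal.ofReal_mul dist_nonneg, ← ENNReal.ofReal_one]
          refine ENNReal.ofReal_le_ofReal ?_
          rw [← div_eq_mul_inv, div_le_one hpos]
          linarith [hδ.le]
      _ = C * (M z.1 + M z.2) := mul_one _
  -- integrate
  calc ‖∫ z, (g z.1 - g z.2) ∂π‖ₑ ≤ ∫⁻ z, ‖g z.1 - g z.2‖ₑ ∂π := enorm_integral_le_lintegral_enorm _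
    _ ≤ ∫⁻ z, C * (M z.1 + M z.2) ∂π := lintegral_mono_ae hpt
    _ = C * ∫⁻ x, ‖θ x‖ₑ * M x := by
        rw [lintegral_const_mul' _ _ hCt, lintegral_add_comp_eq_of_isCoupling hθ.1 hπ hMm]
    _ ≤ C * (eLpNorm θ 2 volume * (∫⁻ x, M x ^ 2) ^ (1 / 2 : ℝ)) := by
        refine mul_le_mul' le_rfl ?_
        have hH := ENNReal.lintegral_mul_le_Lp_mul_Lq (volume : Measure (UnitAddTorus d))
          Real.HolderConjugate.two_two hθ.1.enorm hMm.aemeasurable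
        rw [eLpNorm_eq_lintegral_rpow_enorm_toReal two_ne_zero ENNReal.ofNat_ne_top, ENNReal.toReal_ofNat]
        refine hH.trans (le_of_eq ?_)
        congr 2
        exact lintegral_congr fun x => (ENNReal.rpow_two _)
    _ ≤ C * (eLpNorm θ 2 volume * (C * (Fintype.card d * eGradNormSq u)) ^ (1 / 2 : ℝ)) := by
        gcongr
        exact hM2.trans (mul_le_mul' le_rfl (lintegral_enorm_fderiv_sq_le_card_mul_eGradNormSq hu))
    _ = pairingConst d * eLpNorm θ 2 volume * eGradNormSq u ^ (1 / 2 : ℝ) := by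
        rw [pairingConst, ← hC_def, show C * ((Fintype.card d : ℝ≥0∞) * eGradNormSq u) =
          (C * Fintype.card d) * eGradNormSq u by ring,
          ENNReal.mul_rpow_of_nonneg _ (eGradNormSq u) (by norm_num : (0 : ℝ) ≤ 1 / 2)]
        ring

/-! ## The bound for `L² ∩ Ḣ¹` drifts -/

omit [DecidableEq d] in
/-- The pairing integrand `θ ⟪v, ∇ζ⟫` is integrable for `θ, v ∈ L²` and log-Lipschitz `ζ`. [folklore] -/
theorem integrable_mul_inner_gradient {θ : UnitAddTorus d → ℝ} (hθ : MemLp θ 2 volume)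
    {δ : ℝ} (hδ : 0 < δ) {ζ : UnitAddTorus d → ℝ} (hζ : IsLogLipschitz δ ζ)
    {v : UnitAddTorus d → EuclideanSpace ℝ d} (hv : MemLp v 2 volume) :
    Integrable (fun x => θ x * ⟪v x, Torus.gradient ζ x⟫_ℝ) volume := by
  have hfin : eLpNorm θ 2 volume * eLpNorm v 2 volume ≠ ⊤ := ENNReal.mul_ne_top hθ.eLpNorm_ne_top hv.eLpNorm_ne_top
  have hH : ∫⁻ x, ‖θ x‖ₑ * ‖v x‖ₑ ≤ eLpNorm θ 2 volume * eLpNorm v 2 volume := by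
    have := ENNReal.lintegral_mul_le_Lp_mul_Lq (volume : Measure (UnitAddTorus d))
      Real.HolderConjugate.two_two hθ.1.enorm hv.1.enorm
    rw [eLpNorm_eq_lintegral_rpow_enorm_toReal two_ne_zero ENNReal.ofNat_ne_top,
      eLpNorm_eq_lintegral_rpow_enorm_toReal two_ne_zero ENNReal.ofNat_ne_top, ENNReal.toReal_ofNat]
    exact this
  have hprod : Integrable (fun x => ‖θ x‖ * ‖v x‖) volume := by
    refine ⟨hθ.1.norm.mul hv.1.norm, ?_⟩
    rw [hasFiniteIntegral_iff_enorm]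
    refine lt_of_le_of_lt (lintegral_mono fun x => ?_) (hH.trans_lt hfin.lt_top)
    rw [enorm_mul, enorm_norm, enorm_norm]
  refine Integrable.mono' (hprod.const_mul δ⁻¹)
    (hθ.1.mul (hv.1.inner (measurable_gradient ζ).aestronglyMeasurable)) (Eventually.of_forall fun x => ?_)
  rw [norm_mul, Real.norm_eq_abs, Real.norm_eq_abs]
  calc |θ x| * |⟪v x, Torus.gradient ζ x⟫_ℝ| ≤ |θ x| * (‖v x‖ * δ⁻¹) :=
        mul_le_mul_of_nonneg_left ((abs_real_inner_le_norm _ _).trans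
          (mul_le_mul_of_nonneg_left (hζ.norm_gradient_le_inv hδ x) (norm_nonneg _))) (abs_nonneg _)
    _ = δ⁻¹ * (‖θ x‖ * ‖v x‖) := by rw [Real.norm_eq_abs]; ring

omit [DecidableEq d] in
/-- Continuity of the pairing in the drift: `|∫ θ ⟪v, ∇ζ⟫| ≤ δ⁻¹ (‖θ‖_{L²} ‖v‖_{L²}).toReal`
for a `δ`-log-Lipschitz `ζ`. [folklore] -/
theorem abs_integral_mul_inner_gradient_le {θ : UnitAddTorus d → ℝ} (hθ : MemLp θ 2 volume)
    {δ : ℝ} (hδ : 0 < δ) {ζ : UnitAddTorus d → ℝ} (hζ : IsLogLipschitz δ ζ)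
    {v : UnitAddTorus d → EuclideanSpace ℝ d} (hv : MemLp v 2 volume) :
    |∫ x, θ x * ⟪v x, Torus.gradient ζ x⟫_ℝ| ≤ δ⁻¹ * (eLpNorm θ 2 volume * eLpNorm v 2 volume).toReal := by
  have hfin : eLpNorm θ 2 volume * eLpNorm v 2 volume ≠ ⊤ := ENNReal.mul_ne_top hθ.eLpNorm_ne_top hv.eLpNorm_ne_top
  have hH : ∫⁻ x, ‖θ x‖ₑ * ‖v x‖ₑ ≤ eLpNorm θ 2 volume * eLpNorm v 2 volume := by
    have := ENNReal.lintegral_mul_le_Lp_mul_Lq (volume : Measure (UnitAddTorus d))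
      Real.HolderConjugate.two_two hθ.1.enorm hv.1.enorm
    rw [eLpNorm_eq_lintegral_rpow_enorm_toReal two_ne_zero ENNReal.ofNat_ne_top,
      eLpNorm_eq_lintegral_rpow_enorm_toReal two_ne_zero ENNReal.ofNat_ne_top, ENNReal.toReal_ofNat]
    exact this
  -- the integrand is dominated by `δ⁻¹ |θ| ‖v‖`, which is integrable
  have hprod : Integrable (fun x => ‖θ x‖ * ‖v x‖) volume := by
    refine ⟨hθ.1.norm.mul hv.1.norm, ?_⟩
    rw [hasFiniteIntegral_iff_enorm]
    refine lt_of_le_of_lt (lintegral_mono fun x => ?_) (hH.trans_lt hfin.lt_top)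
    rw [enorm_mul, enorm_norm, enorm_norm]
  rw [← Real.norm_eq_abs]
  refine (norm_integral_le_of_norm_le (hprod.const_mul δ⁻¹) (Eventually.of_forall fun x => ?_)).trans ?_
  · rw [norm_mul, Real.norm_eq_abs, Real.norm_eq_abs]
    calc |θ x| * |⟪v x, Torus.gradient ζ x⟫_ℝ| ≤ |θ x| * (‖v x‖ * δ⁻¹) :=
          mul_le_mul_of_nonneg_left ((abs_real_inner_le_norm _ _).trans
            (mul_le_mul_of_nonneg_left (hζ.norm_gradient_le_inv hδ x) (norm_nonneg _))) (abs_nonneg _)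
      _ = δ⁻¹ * (‖θ x‖ * ‖v x‖) := by rw [Real.norm_eq_abs]; ring
  · rw [MeasureTheory.integral_const_mul]
    refine mul_le_mul_of_nonneg_left ?_ (inv_nonneg.2 hδ.le)
    rw [integral_eq_lintegral_of_nonneg_ae (f := fun x => ‖θ x‖ * ‖v x‖)
      (Eventually.of_forall fun x => mul_nonneg (norm_nonneg _) (norm_nonneg _)) (hθ.1.norm.mul hv.1.norm)]
    refine ENNReal.toReal_mono hfin ((lintegral_congr fun x => ?_).trans_le hH)
    rw [ENNReal.ofReal_mul (norm_nonneg _), ofReal_norm, ofReal_norm]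

/-- **The transport pairing bound** (Seis 2022, proof of Lemma 3, the estimate
`|d/dt D_δ(ρ)| ≲ ‖∇u‖_{L^p} ‖ρ‖_{L^q}` at `p = q = 2`, in its static form): for mean-zero
`θ ∈ L²`, a coupling `π` of `θ⁺dx`, `θ⁻dx` and a `δ`-log-Lipschitz `ζ` with `∇ζ(x) = ∇ζ(y)`,
`|∇ζ(x)| ≤ (δ + |x-y|)⁻¹` for `π`-a.e. `(x,y)` (as provided by
`exists_isCoupling_gradient`), and any drift `u ∈ L²(T^d; ℝ^d)`:
`‖∫ θ ⟪u, ∇ζ⟫‖ₑ ≤ pairingConst d · ‖θ‖_{L²} · (eGradNormSq u)^{1/2}`, uniformly in `δ`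
(smooth case and mollification `u ⋆ k_ε → u` in `L²` with `eGradNormSq (u ⋆ k_ε) ≤ eGradNormSq u`).
[cite: Seis2022, Lemma 3 (proof, pp. 7–8)] -/
theorem enorm_integral_mul_inner_gradient_le {θ : UnitAddTorus d → ℝ} (hθ : MemLp θ 2 volume)
    {δ : ℝ} (hδ : 0 < δ) {π : Measure (UnitAddTorus d × UnitAddTorus d)}
    (hπ : IsCoupling (posMeasure θ) (negMeasure θ) π) {ζ : UnitAddTorus d → ℝ} (hζ : IsLogLipschitz δ ζ)
    (hae : ∀ᵐ z ∂π, Torus.gradient ζ z.1 = Torus.gradient ζ z.2 ∧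
      ‖Torus.gradient ζ z.1‖ ≤ (δ + dist z.1 z.2)⁻¹)
    {u : UnitAddTorus d → EuclideanSpace ℝ d} (hu : MemLp u 2 volume) :
    ‖∫ x, θ x * ⟪u x, Torus.gradient ζ x⟫_ℝ‖ₑ ≤
      pairingConst d * eLpNorm θ 2 volume * eGradNormSq u ^ (1 / 2 : ℝ) := by
  have hui : Integrable u volume := hu.integrable one_le_two
  -- mollify at radii `εₙ = 1/(4(n+1))`
  set ε : ℕ → ℝ := fun n => 1 / (4 * ((n : ℝ) + 1)) with hε_def
  have hε : ∀ n, 0 < ε n := fun n => by rw [hε_def]; positivity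
  have hε' : ∀ n, ε n ≤ 1 / 4 := fun n => by
    rw [hε_def]
    dsimp only
    rw [div_le_div_iff₀ (by positivity) (by norm_num)]
    nlinarith [(Nat.cast_nonneg n : (0 : ℝ) ≤ n)]
  have hε0 : Tendsto ε atTop (𝓝 0) := by
    have h1 : Tendsto (fun n : ℕ => 4 * ((n : ℝ) + 1)) atTop atTop :=
      Tendsto.const_mul_atTop (by norm_num) (tendsto_natCast_atTop_atTop.atTop_add tendsto_const_nhds)
    exact tendsto_const_nhds.div_atTop h1
  set T : (UnitAddTorus d → EuclideanSpace ℝ d) → ℝ := fun v => ∫ x, θ x * ⟪v x, Torus.gradient ζ x⟫_ℝ with hT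
  set R : ℝ≥0∞ := pairingConst d * eLpNorm θ 2 volume * eGradNormSq u ^ (1 / 2 : ℝ) with hR
  -- the bound for the mollified drifts
  have hbound : ∀ n, ‖T (vecMollify (ε n) u)‖ₑ ≤ R := by
    intro n
    refine (enorm_integral_mul_inner_gradient_le_of_isSmooth hθ hδ hπ hζ hae
      (isSmooth_vecMollify hui (hε n) (hε' n))).trans ?_
    rw [hR]
    gcongr
    exact eGradNormSq_vecMollify_le hui (hε n) (hε' n)
  -- convergence `T (u ⋆ k_εₙ) → T u`
  have hlim : Tendsto (fun n => T (vecMollify (ε n) u)) atTop (𝓝 (T u)) := by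
    have hmem : ∀ n, MemLp (vecMollify (ε n) u) 2 volume := fun n => by
      have hc := (isSmooth_vecMollify hui (hε n) (hε' n)).continuous
      obtain ⟨C, hC⟩ := exists_forall_norm_le_of_continuous hc
      exact (memLp_top_of_bound hc.aestronglyMeasurable C (Eventually.of_forall hC)).mono_exponent le_top
    -- `T vₙ - T u = T (vₙ - u)` and `|T (vₙ - u)| ≤ δ⁻¹ ‖θ‖₂ ‖vₙ - u‖₂ → 0`
    have hdiff : ∀ n, T (vecMollify (ε n) u) - T u =
        ∫ x, θ x * ⟪(vecMollify (ε n) u - u) x, Torus.gradient ζ x⟫_ℝ := by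
      intro n
      simp only [hT]
      rw [← integral_sub (integrable_mul_inner_gradient hθ hδ hζ (hmem n))
        (integrable_mul_inner_gradient hθ hδ hζ hu)]
      refine integral_congr_ae (Eventually.of_forall fun x => ?_)
      simp only [Pi.sub_apply, inner_sub_left]
      ring
    have hE := tendsto_eLpNorm_vecMollify_sub hu hε hε' hε0
    have hE' : Tendsto (fun n => δ⁻¹ * (eLpNorm θ 2 volume * eLpNorm (vecMollify (ε n) u - u) 2 volume).toReal)
        atTop (𝓝 0) := by
      have h1 := ENNReal.Tendsto.const_mul hE (Or.inr hθ.eLpNorm_ne_top : (0 : ℝ≥0∞) ≠ 0 ∨ eLpNorm θ 2 volume ≠ ⊤)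
      rw [mul_zero] at h1
      have h2 := (ENNReal.tendsto_toReal ENNReal.zero_ne_top).comp h1
      rw [ENNReal.toReal_zero] at h2
      have h3 := h2.const_mul δ⁻¹
      rw [mul_zero] at h3
      exact h3
    rw [tendsto_iff_norm_sub_tendsto_zero]
    refine squeeze_zero (fun n => norm_nonneg _) (fun n => ?_) hE'
    rw [Real.norm_eq_abs, hdiff n]
    exact abs_integral_mul_inner_gradient_le hθ hδ hζ ((hmem n).sub hu)
  have hlim' : Tendsto (fun n => ‖T (vecMollify (ε n) u)‖ₑ) atTop (𝓝 ‖T u‖ₑ) := hlim.enorm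
  exact le_of_tendsto' hlim' hbound

end Torus

end Literature.Analysis.FunctionSpaces
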